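import Literature.AlgebraicGeometry.Resolution.Kuhlmann2019Lemma41
import Literature.AlgebraicGeometry.Resolution.HenselizedRationalArtinSchreier
import Literature.AlgebraicGeometry.Resolution.NormalDegreePDefectless
import Literature.AlgebraicGeometry.Resolution.PthRootsOfOneUnits
import Mathlib.FieldTheory.KummerExtension
import HarnessLib

/-!
# Kuhlmann 2019, §4, (4.4): Kummer generators of Galois extensions of degree `p` of `K(x)^h` in mixed characteristic, with radicand `1 + f(x)`, `f ∈ K[x]`

Topic: `Literature/AlgebraicGeometry/Resolution` (valued function fields). Twin of
`Kuhlmann2019Prop48Setup.lean` ((4.3), equal characteristic) for the mixed-characteristic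
half (Prop. 4.9) of the degree-`p` step `(hstep)` to which `Kuhlmann2019Prop52Reduction.lean`
reduces the named fact `Kuhlmann2019_Prop52_sepClosed`. F.-V. Kuhlmann, *Elimination of
ramification II: Henselian rationality*, Israel J. Math. 234 (2019) = arXiv:1701.05508, §4
(p. 7):

> If `char K = 0` and `K` contains the `p`-th roots of unity, then `E|K(x)^h` is generated by
> an element `η ∈ E` which satisfies (4.2) `η^p = a ∈ K(x)^h` ([24, VI, §6, Theorem 6.2]).
> Here, `a` can be replaced by any other nonzero element in `a · (K(x)^h)^p`. […] Assume now
> that the rank of `(K, v)` is 1 and that `char K = 0`. Assume in addition that `K` is closed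
> under `p`-th roots. Since `a` lies in an immediate extension of `(K, v)`, we know that
> `va ∈ vK`, so there is some `d₁ ∈ K` such that `vd₁^p = −va` and therefore, `vd₁^p a = 0`.
> For the same reason, `d₁^p a v ∈ Kv` and there is some [`d₂ ∈ K` with `d^p a = 1 + b`,
> `vb > 0`, `d = d₁d₂`, so] that `dη` generates `E|K(x)^h` with `(dη)^p = d^p a = 1 + b` […
> by Lemma 4.1 and part a) of Lemma 3.1 …]. Note that this implies that `vf(x) > 0`, i.e.,
> `1 + f(x)` is a 1-unit. Hence by part a) of Lemma 3.1, any root of the polynomial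
> `X^p − (1 + f(x))` will also generate the extension `E|K(x)^h`. So we can assume from the
> start: (4.4) `E = K(x)^h(η)` with `η^p = 1 + f(x)`, `f(x) ∈ K[x]`, `vf(x) > 0`.

(Lemma 3.1 a) = Kuhlmann 2010, Lemma 2.10: in a henselian field containing the `p`-th roots of
unity, a `1`-unit `1 + b` with `vb > (p/(p−1))vp` is a `p`-th power.) This file PROVES (4.4)
in the setting of Prop. 5.2 (`K` separably closed — hence algebraically closed, `char K = 0` —
of rank one, `z` transcendental with `(K(z)|K, v)` immediate, `char Ωv = p`):
`exists_kummer_generator_one_add_eval`. Ingredients, all PROVED in the tree or Mathlib: the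
Kummer generator of a cyclic extension of degree `p` (Mathlib `exists_root_adjoin_eq_top_of_isCyclic`,
[24, VI §6 Thm. 6.2]; primitive `p`-th roots of unity in the algebraically closed `K`,
`exists_isPrimitiveRoot_mem_of_isAlgClosed`); `d₁, d₂ ∈ K` by immediateness of `K(z)^h|K`
(`Kuhlmann2010HenselizationImmediate_holds`) and `p`-th roots in `K`; Lemma 4.1 with the bound
`v(C^p)`, `C^{p−1} = −p` (`exists_polynomial_valuation_sub_lt_of_isSepClosed`,
`Kuhlmann2019Lemma41.lean`); Lemma 2.10 (`exists_pow_eq_one_add_of_valuation_lt`,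
`PthRootsOfOneUnits.lean`, over the henselian `K(z)^h`, `Kuhlmann2010HenselizationIsHenselian_holds`);
`K(z)^h(s·η) = K(z)^h(η)` for `s ∈ (K(z)^h)^×` (`adjoin_simple_mul_of_mem`).

What remains for Prop. 4.9 after (4.4): the normal form of Lemma 4.3 for `f(x)` (Ershov's
`δ`-function, §3) and Lemma 4.7 (= [23, Thm. 9.1 with Cor. 7.7]).

## Sources

* [K19] F.-V. Kuhlmann, Israel J. Math. 234 (2019) = arXiv:1701.05508: §3 Lemma 3.1, §4
  (4.2), (4.4), Lemma 4.1, Prop. 4.9. [Kuhlmann2019]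
* [K10] F.-V. Kuhlmann, Trans. AMS 362 (2010) = arXiv:1003.5678: §2.2, Lemma 2.10.
  [Kuhlmann2010]
* [24] S. Lang, *Algebra*, GTM 211 (2002): Ch. VI §6, Thm. 6.2 (Kummer). [Lang2002]

## Rendering notes

As in `Kuhlmann2019Prop48Setup.lean`; mixed characteristic `(0, p)` = `CharZero Ω` and
`CharP (ResidueField V) p`; `vf(x) > 0` = `V.valuation (f.eval z) < 1`. No definition is
introduced.
-/

noncomputable section

namespace Literature.AlgebraicGeometry.Resolution

universe u

open Polynomial IsLocalRing IntermediateField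

variable {Ω : Type u} [Field Ω] [IsAlgClosed Ω] (V : ValuationSubring Ω) (K : Subfield Ω)

omit [IsAlgClosed Ω] V in
/-- `F⟮s·η⟯ = F⟮η⟯` for a unit `s` of `F`. [folklore] -/
theorem adjoin_simple_mul_of_mem {F : Subfield Ω} {s : Ω} (hsF : s ∈ F) (hs0 : s ≠ 0) (η : Ω) :
    F⟮s * η⟯ = F⟮η⟯ := by
  apply le_antisymm
  · rw [IntermediateField.adjoin_simple_le_iff]
    exact mul_mem (IntermediateField.algebraMap_mem F⟮η⟯ ⟨s, hsF⟩)
      (IntermediateField.mem_adjoin_simple_self F η)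
  · rw [IntermediateField.adjoin_simple_le_iff]
    have hmem : (s : Ω)⁻¹ * (s * η) ∈ F⟮s * η⟯ :=
      mul_mem (IntermediateField.algebraMap_mem F⟮s * η⟯ ⟨s⁻¹, F.inv_mem hsF⟩)
        (IntermediateField.mem_adjoin_simple_self F _)
    rwa [← mul_assoc, inv_mul_cancel₀ hs0, one_mul] at hmem

/-- **Kuhlmann 2019, §4, (4.4).** Let `K ≤ Ω` be separably closed of rank one, `char Ω = 0`,
`char Ωv = p`, `z` transcendental over `K` with `(K(z)|K, V)` immediate, and let `E` be a Galois
extension of degree `p` of `K(z)^h = henselization V K(z)` inside `Ω`. Then `E = K(z)^h(η)` for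
some `η ∈ E` with `η^p = 1 + f(z)`, `f` a polynomial over `K` with `v(f(z)) < 1`. PROVED along
the printed lines (module docstring): Kummer generator `a`, `a^p ∈ K(z)^h`; `(d₁d₂a)^p = 1 + b'`
with `d₁, d₂ ∈ K`, `v(b') < 1`; `b' = f(z) + (b' − f(z))` with `v(b' − f(z)) < v(C)^p` by
Lemma 4.1; `1 + b' = (1 + f(z))(1 + m)`, `1 + m = w^p` by Lemma 2.10; `η = d₁d₂a/w`.
[cite: Kuhlmann2019, Section 4, (4.4)] -/
theorem exists_kummer_generator_one_add_eval {p : ℕ} [Fact p.Prime] [CharZero Ω]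
    [CharP (ResidueField V) p] [IsSepClosed K]
    {z : Ω} (hz : Transcendental K z)
    (himm : IsImmediateOver V K (Subfield.closure ((K : Set Ω) ∪ {z}))) (hr : IsRankOne V K)
    {E : Subfield Ω} (hE : IsGaloisStep p (henselization V (Subfield.closure ((K : Set Ω) ∪ {z}))) E) :
    ∃ η ∈ E, ∃ f : Polynomial Ω, (∀ k, f.coeff k ∈ K) ∧ V.valuation (f.eval z) < 1 ∧
      η ^ p = 1 + f.eval z ∧
      E = Subfield.closure
        ((henselization V (Subfield.closure ((K : Set Ω) ∪ {z})) : Set Ω) ∪ {η}) := by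
  classical
  have hp : p.Prime := Fact.out
  set Kz : Subfield Ω := Subfield.closure ((K : Set Ω) ∪ {z}) with hKzdef
  set L : Subfield Ω := henselization V Kz with hLdef
  have hKKz : K ≤ Kz := fun c hc => Subfield.subset_closure (Or.inl hc)
  have hzKz : z ∈ Kz := Subfield.subset_closure (Or.inr rfl)
  have hKzL : Kz ≤ L := le_henselization V Kz
  have hKL : K ≤ L := hKKz.trans hKzL
  -- `K` is algebraically closed (separably closed of characteristic `0`)
  haveI : CharZero K := SubsemiringClass.instCharZero K
  haveI hKalg : IsAlgClosed K := IsSepClosed.isAlgClosed_of_perfectField K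
  -- `p ≠ 0` in `Ω`, `v(p) < 1`, the constant `C ∈ K`
  have hp0 : (p : Ω) ≠ 0 := Nat.cast_ne_zero.mpr hp.ne_zero
  have hvp : V.valuation (p : Ω) < 1 := by
    have h0 : residue V (p : V) = 0 := by
      rw [map_natCast]
      exact CharP.cast_eq_zero (ResidueField V) p
    have h1 := (ValuationSubring.valuation_lt_one_iff V (p : V)).mp ((residue_eq_zero_iff _).mp h0)
    simpa using h1
  obtain ⟨C', hC'⟩ := IsAlgClosed.exists_pow_nat_eq (-(p : K)) (Nat.sub_pos_of_lt hp.one_lt)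
  set C : Ω := (C' : Ω) with hCdef
  have hCK : C ∈ K := C'.2
  have hC : C ^ (p - 1) = -(p : Ω) := by
    have := congrArg (fun c : K => (c : Ω)) hC'
    simpa using this
  have hC0 : C ≠ 0 := C_ne_zero hp hC hp0
  have hCp0 : C ^ p ≠ 0 := pow_ne_zero p hC0
  have hvCp1 : V.valuation C ^ p < 1 := valuation_C_pow_lt_one V hp hC hvp
  -- `L = K(z)^h` is henselian and immediate over `K`
  have hLh : IsHenselianField L (V.comap (algebraMap L Ω)) :=
    Kuhlmann2010HenselizationIsHenselian_holds Ω V Kz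
  have himmL : IsImmediateOver V K L := himm.trans (Kuhlmann2010HenselizationImmediate_holds Ω V Kz)
  -- the Galois step as an intermediate field over `L`; a Kummer generator `α`
  obtain ⟨hle, hdeg, hgal⟩ := hE
  haveI := hgal
  haveI : FiniteDimensional L (Subfield.extendScalars hle) :=
    Module.finite_of_finrank_pos (by rw [hdeg]; exact hp.pos)
  haveI : IsCyclic (Subfield.extendScalars hle ≃ₐ[L] Subfield.extendScalars hle) :=
    isCyclic_of_prime_card (p := p) (by rw [IsGalois.card_aut_eq_finrank, hdeg])
  obtain ⟨ζ, hζK, hζ⟩ := exists_isPrimitiveRoot_mem_of_isAlgClosed hKalg hp0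
  have hprim : (primitiveRoots (Module.finrank L (Subfield.extendScalars hle)) L).Nonempty := by
    refine ⟨⟨ζ, hKL hζK⟩, ?_⟩
    rw [hdeg, mem_primitiveRoots hp.pos]
    exact IsPrimitiveRoot.of_map_of_injective (f := algebraMap L Ω) hζ Subtype.val_injective
  obtain ⟨α, hαp, hαtop⟩ := exists_root_adjoin_eq_top_of_isCyclic L (Subfield.extendScalars hle) hprim
  rw [hdeg] at hαp
  obtain ⟨b, hb⟩ := hαp
  set a : Ω := ((α : Subfield.extendScalars hle) : Ω) with hadef
  have haE : a ∈ E := (α : Subfield.extendScalars hle).2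
  have hapL : a ^ p ∈ L := by
    have h1 : (((α ^ p : Subfield.extendScalars hle)) : Ω) = a ^ p := by simp [hadef]
    have h2 : ((algebraMap L (Subfield.extendScalars hle) b : Subfield.extendScalars hle) : Ω) = (b : Ω) := rfl
    rw [← h1, ← hb, h2]
    exact b.2
  have hgen : L⟮a⟯ = Subfield.extendScalars hle := by
    have h := congrArg (IntermediateField.lift (F := Subfield.extendScalars hle)) hαtop
    rw [IntermediateField.lift_adjoin_simple, IntermediateField.lift_top] at h
    exact h
  have ha0 : a ≠ 0 := by
    intro h0
    have hbot : L⟮a⟯ = ⊥ := by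
      rw [IntermediateField.adjoin_simple_eq_bot_iff, h0]
      exact zero_mem _
    have h1 : Module.finrank L (Subfield.extendScalars hle) = 1 := by
      rw [← hgen, hbot, IntermediateField.finrank_bot]
    rw [hdeg] at h1
    exact hp.one_lt.ne' h1
  -- `a^p = d^{-p}(1 + b')` with `d ∈ K^×`, `v(b') < 1` (immediateness, `K` closed under `p`-th roots)
  have hap0 : a ^ p ≠ 0 := pow_ne_zero p ha0
  obtain ⟨c₀, hc₀K, hvc₀⟩ := himmL.1 (a ^ p) hapL hap0
  have hc₀0 : c₀ ≠ 0 := by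
    rintro rfl
    rw [map_zero, map_eq_zero] at hvc₀
    exact hap0 hvc₀
  obtain ⟨d₁', hd₁'⟩ := IsAlgClosed.exists_pow_nat_eq ((⟨c₀, hc₀K⟩ : K)⁻¹) hp.pos
  set d₁ : Ω := (d₁' : Ω) with hd₁def
  have hd₁K : d₁ ∈ K := d₁'.2
  have hd₁p : d₁ ^ p = c₀⁻¹ := by
    have := congrArg (fun c : K => (c : Ω)) hd₁'
    simpa using this
  have hd₁0 : d₁ ≠ 0 := by
    intro h0
    rw [h0, zero_pow hp.ne_zero, eq_comm, inv_eq_zero] at hd₁p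
    exact hc₀0 hd₁p
  set t : Ω := d₁ ^ p * a ^ p with htdef
  have htL : t ∈ L := mul_mem (pow_mem (hKL hd₁K) p) hapL
  have hvt : V.valuation t = 1 := by
    have hvc₀0 : V.valuation c₀ ≠ 0 := (_root_.map_ne_zero _).mpr hc₀0
    rw [htdef, map_mul, hd₁p, map_inv₀, hvc₀, inv_mul_cancel₀ hvc₀0]
  have htV : t ∈ V := (V.valuation_le_one_iff t).mp hvt.le
  obtain ⟨e, heK, hvte⟩ : ∃ e ∈ K, V.valuation (t - e) < 1 := by
    have hrt : residue V ⟨t, htV⟩ ∈ resField V K := himmL.2 (residue_mem_resField V ⟨t, htV⟩ htL)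
    obtain ⟨e, heK, het⟩ := (mem_resField_iff V K _).mp hrt
    refine ⟨e, heK, ?_⟩
    have h0 : residue V (⟨t, htV⟩ - e) = 0 := by rw [map_sub, het, sub_self]
    exact (ValuationSubring.valuation_lt_one_iff V (⟨t, htV⟩ - e)).mp ((residue_eq_zero_iff _).mp h0)
  have hve : V.valuation e = 1 := by
    have he : e = t + -(t - e) := by ring
    have hlt : V.valuation (-(t - e)) < V.valuation t := by rw [Valuation.map_neg, hvt]; exact hvte
    rw [he, V.valuation.map_add_eq_of_lt_left hlt, hvt]
  have he0 : e ≠ 0 := by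
    rintro rfl
    rw [map_zero] at hve
    exact zero_ne_one hve
  obtain ⟨d₂', hd₂'⟩ := IsAlgClosed.exists_pow_nat_eq ((⟨e, heK⟩ : K)⁻¹) hp.pos
  set d₂ : Ω := (d₂' : Ω) with hd₂def
  have hd₂K : d₂ ∈ K := d₂'.2
  have hd₂p : d₂ ^ p = e⁻¹ := by
    have := congrArg (fun c : K => (c : Ω)) hd₂'
    simpa using this
  have hd₂0 : d₂ ≠ 0 := by
    intro h0
    rw [h0, zero_pow hp.ne_zero, eq_comm, inv_eq_zero] at hd₂p
    exact he0 hd₂p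
  set b' : Ω := e⁻¹ * (t - e) with hb'def
  have hb'L : b' ∈ L := mul_mem (L.inv_mem (hKL heK)) (sub_mem htL (hKL heK))
  have hvb' : V.valuation b' < 1 := by
    rw [hb'def, map_mul, map_inv₀, hve, inv_one, one_mul]
    exact hvte
  have hkey₁ : (d₁ * d₂ * a) ^ p = 1 + b' := by
    have h1 : (d₁ * d₂ * a) ^ p = e⁻¹ * t := by
      rw [mul_pow, mul_pow, hd₂p, htdef]
      ring
    rw [h1, hb'def, mul_sub, inv_mul_cancel₀ he0]
    ring
  -- Lemma 4.1 with `c = C^p`: `v(b' − f(z)) < v(C)^p`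
  have hCpKz : C ^ p ∈ Kz := pow_mem (hKKz hCK) p
  obtain ⟨f, hf, hvf⟩ := exists_polynomial_valuation_sub_lt_of_isSepClosed V K hz himm hr hb'L hCpKz hCp0
  rw [map_pow] at hvf
  have hfzKz : f.eval z ∈ Kz := eval_mem_subfield_of_coeff_mem (fun k => hKKz (hf k)) hzKz
  have hfzL : f.eval z ∈ L := hKzL hfzKz
  have hvbf1 : V.valuation (b' - f.eval z) < 1 := hvf.trans hvCp1
  have hvfz : V.valuation (f.eval z) < 1 := by
    have hsum : f.eval z = b' + -(b' - f.eval z) := by ring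
    rw [hsum]
    refine lt_of_le_of_lt (V.valuation.map_add _ _) (max_lt hvb' ?_)
    rw [Valuation.map_neg]
    exact hvbf1
  have h1f : V.valuation (1 + f.eval z) = 1 := by
    have hlt : V.valuation (f.eval z) < V.valuation (1 : Ω) := by rw [map_one]; exact hvfz
    rw [V.valuation.map_add_eq_of_lt_left hlt, map_one]
  have h1f0 : 1 + f.eval z ≠ 0 := fun h0 => by
    rw [h0, map_zero] at h1f
    exact zero_ne_one h1f
  -- `1 + b' = (1 + f(z))(1 + m)`, `v(m) < v(C)^p`, so `1 + m = w^p` (Kuhlmann 2010, Lemma 2.10)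
  set m : Ω := (b' - f.eval z) / (1 + f.eval z) with hmdef
  have hmL : m ∈ L := div_mem (sub_mem hb'L hfzL) (add_mem L.one_mem hfzL)
  have hvm : V.valuation m < V.valuation C ^ p := by
    rw [hmdef, map_div₀, h1f, div_one]
    exact hvf
  have hsplit : 1 + b' = (1 + f.eval z) * (1 + m) := by
    rw [hmdef]
    field_simp
    ring
  obtain ⟨w, hwL, hwp⟩ :=
    exists_pow_eq_one_add_of_valuation_lt V hLh hp (hKL hCK) hC hp0 hvp hmL hvm
  have h1m : V.valuation (1 + m) = 1 := by
    have hlt : V.valuation m < V.valuation (1 : Ω) := by rw [map_one]; exact hvm.trans hvCp1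
    rw [V.valuation.map_add_eq_of_lt_left hlt, map_one]
  have h1m0 : 1 + m ≠ 0 := fun h0 => by
    rw [h0, map_zero] at h1m
    exact zero_ne_one h1m
  have hw0 : w ≠ 0 := by
    rintro rfl
    rw [zero_pow hp.ne_zero] at hwp
    exact h1m0 hwp.symm
  -- the generator `η = d₁ d₂ a / w`
  set s : Ω := d₁ * d₂ / w with hsdef
  have hsL : s ∈ L := div_mem (mul_mem (hKL hd₁K) (hKL hd₂K)) hwL
  have hs0 : s ≠ 0 := div_ne_zero (mul_ne_zero hd₁0 hd₂0) hw0
  refine ⟨s * a, mul_mem (hle hsL) haE, f, hf, hvfz, ?_, ?_⟩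
  · have hsa : s * a = d₁ * d₂ * a / w := by rw [hsdef]; ring
    rw [hsa, div_pow, hkey₁, hwp, hsplit, mul_div_assoc, div_self h1m0, mul_one]
  · have hadj : L⟮s * a⟯ = Subfield.extendScalars hle := by
      rw [adjoin_simple_mul_of_mem hsL hs0, hgen]
    have h2 := congrArg IntermediateField.toSubfield hadj
    rw [Subfield.extendScalars_toSubfield, adjoin_toSubfield_eq_closure] at h2
    exact h2.symm

end Literature.AlgebraicGeometry.Resolution

end
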